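import Mathlib
import Literature.NumberTheory.LFunctions.Zhang2022.Section15CVarpiMult
import Literature.NumberTheory.LFunctions.Zhang2022.TypedAppendixA1Identities
import Literature.NumberTheory.LFunctions.Zhang2022.Section15BCalM1Analytic
import HarnessLib

/-!
# Zhang (2022), §15 p. 85 / App. A p. 105: the Euler factors of `𝓜₁(d,l;s)` at a prime `q` for
# `d, l` powers of `q` — kernel-checked local identities and bounds

Topic `Literature/NumberTheory/LFunctions/Zhang2022` (Landau–Siegel audit tree; verdict-neutral).
Y. Zhang, *Discrete mean estimates and the Landau–Siegel zero*, arXiv:2211.02515v1 (2022)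
[Zhang2022LandauSiegel] — **an unrefereed manuscript under adjudication; nothing in this file asserts
or denies its Theorems 1–2.** ZHANG-L discharge lane (WP15), second file of the chain towards the leaf
`Typed.Section15C.Lemma153RpI` (Lemma 15.3, analytic part, repaired normaliser `calU1R`; rows
G-L4t3-1 / G-d52-1). The Appendix-A sketch of Lemma 15.3 (p. 105, tex L5172–L5185) computes the Euler
factor `𝔲₁ⱼ(q,s)` of `Σₙ χ(n)τ₂(n)ϖ₁ⱼ(n)n^{−s}`; since `ϖ₁ⱼ(qʳ) = Σ_{a+b=r} λ₁(qᵃ)q^{aβⱼ}χ(qᵇ)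
𝓜₁(qᵃ,qᵇ;1−βⱼ)/𝓜₁(1,1;1−βⱼ)` (§15 p. 85) and, by (15.18), `𝓜₁(qᵃ,qᵇ;s)/𝓜₁(1,1;s)` is the ratio of
the Euler factors AT `q`, everything reduces to the local factors
`calM1Factor(q, d, l, s) = Z_q(s)·(1 + λ̃₁(q,d)Σ_r ξ₁(qʳ;d,l)q^{−rs})` for `d, l ∈ {1, q, q², …}`.

What is PROVED here (theorems only; no new definitions, no facts), for a prime `q`, any `D`, `χ`, `c′`:

* `lamTilde1_prime_prime_pow`, `lam1_prime_pow`, `kappaTilde1_prime_pow_prime_pow` — `λ̃₁(q,qᵃ) = 1`,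
  `λ₁(qᵃ) = λ₁(q)` (`a ≥ 1`), `κ̃₁(qʳ;qᵃ) = κ₁(qʳ)` (`a ≥ 1`; App. A u020).
* `calM1Factor_prime_pow_left/right` — the factor at `q` for `(d,l) = (qᵃ,qᵇ)` depends only on
  `[a ≥ 1]`, `[b ≥ 1]` ((A.5), `Typed.AppendixA1.eqA_5_holds`).
* `xi1LocalSeries_prime_right_sub` — **`Σ_r ξ₁(qʳ;d,q)q^{−rs} − Σ_r ξ₁(qʳ;d,1)q^{−rs}
  = (χ(q)q/(q−1))·Σ_{r≥1} κ₁(q^{r−1})q^{−rs}`**, the same for `d = 1` and `d = q` ((A.5));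
* `xi1LocalSeries_prime_left_sub` — **`Σ_r ξ₁(qʳ;q,1)q^{−rs} − Σ_r ξ₁(qʳ;1,1)q^{−rs}
  = −Σ_{r≥1} (Σ_{k≥1} κ₁(q^{r+k})χ(qᵏ)q^{−k}) q^{−rs}`** (u020 and (15.9) at a prime power);
* the exact differences `calM1Factor(q,1,q,s) − calM1Factor(q,1,1,s)`,
  `λ₁(q)·calM1Factor(q,q,1,s) − calM1Factor(q,1,1,s)` and
  `λ₁(q)·calM1Factor(q,q,q,s) − calM1Factor(q,1,1,s) = (first) + (second)`;
* on `Re s = 1` (where `1 − βⱼ` lives): the bounds `‖first‖, ‖second‖ ≤ C/q` with absolute `C`.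

## References

* Y. Zhang, arXiv:2211.02515v1 (2022), §15 pp. 83–85 ((15.9), (15.10), (15.13), (15.18)); App. A
  p. 103 (u020, (A.5)), p. 105 (proof sketch of Lemma 15.3). [cite: Zhang2022LandauSiegel, §15 p. 85]
-/

noncomputable section

open Complex Real Filter Topology

namespace Literature.NumberTheory.LFunctions.Zhang2022.Lemma153Rp

open Literature.NumberTheory.LFunctions.Zhang2022
open Literature.NumberTheory.LFunctions.Zhang2022.Typed.Section15A
open Literature.NumberTheory.LFunctions.Zhang2022.Typed.Section15B

variable (c' : ℝ) {D : ℕ} (χ : DirichletCharacter ℂ D)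

/-! ## §1. `λ̃₁`, `λ₁`, `κ̃₁` at a prime and its powers -/

/-- `λ̃₁(q, qᵃ) = 1` for `a ≥ 1` (empty product: the only prime factor `q` of `q` is not prime to
`qᵃ`). [cite: Zhang2022LandauSiegel, §15 p. 83] -/
theorem lamTilde1_prime_prime_pow {q a : ℕ} (hq : q.Prime) (ha : 1 ≤ a) :
    lamTilde1 c' χ q (q ^ a) = 1 := by
  unfold lamTilde1
  rw [hq.primeFactors, Finset.filter_singleton, if_neg, Finset.prod_empty]
  intro h
  have : Nat.Coprime q q := Nat.Coprime.coprime_dvd_right (dvd_pow_self q (by omega)) h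
  exact hq.ne_one ((Nat.coprime_self q).mp this)

/-- `λ̃₁(q, 1) = λ₁(q)` for a prime `q`. [cite: Zhang2022LandauSiegel, §15 p. 83] -/
theorem lamTilde1_prime_one_eq {q : ℕ} (hq : q.Prime) : lamTilde1 c' χ q 1 = lam1 c' χ q 1 := by
  unfold lamTilde1
  rw [hq.primeFactors, Finset.filter_singleton, if_pos (Nat.coprime_one_right q),
    Finset.prod_singleton]

/-- `λ₁(qᵃ, s) = λ₁(q, s)` for `a ≥ 1` (`λ₁` is a product over the prime factors).
[cite: Zhang2022LandauSiegel, §15 (15.10) p. 82] -/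
theorem lam1_prime_pow {q a : ℕ} (hq : q.Prime) (ha : 1 ≤ a) (s : ℂ) :
    lam1 c' χ (q ^ a) s = lam1 c' χ q s := by
  unfold lam1
  rw [Nat.primeFactors_prime_pow (by omega) hq, hq.primeFactors]

/-- `κ̃₁(qʳ; qᵃ) = κ₁(qʳ)` for `a ≥ 1` (App. A u020: only `h = 1` is prime to `qᵃ`).
[cite: Zhang2022LandauSiegel, App. A p. 103] -/
theorem kappaTilde1_prime_pow_prime_pow [NeZero D] {q a : ℕ} (hq : q.Prime) (ha : 1 ≤ a) (r : ℕ) :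
    kappaTilde1 c' χ (q ^ r) (q ^ a) 1 = kappa1 c' D (q ^ r) := by
  obtain ⟨a', rfl⟩ : ∃ a', a = a' + 1 := ⟨a - 1, by omega⟩
  rw [pow_succ]
  exact Typed.AppendixA1.stepA_u020_holds c' D χ (q ^ a') q r (Nat.one_le_pow _ _ hq.pos) hq

/-- `κ̃₁(qʳ; 1) = Σ_{k≥0} κ₁(q^{r+k})χ(qᵏ)q^{−k}` for `r ≥ 1` ((15.9) over `𝔫(qʳ) = {qᵏ}`).
[cite: Zhang2022LandauSiegel, §15 (15.9) p. 82] -/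
theorem kappaTilde1_prime_pow_one_eq_tsum {q r : ℕ} (hq : q.Prime) (hr : 1 ≤ r) :
    kappaTilde1 c' χ (q ^ r) 1 1 =
      ∑' k : ℕ, kappa1 c' D (q ^ (r + k)) * χ ((q ^ k : ℕ) : ZMod D) / ((q ^ k : ℕ) : ℂ) := by
  classical
  unfold kappaTilde1
  rw [AppendixALocal.tsum_nset_prime_pow_of_coprime hq (by omega) (Nat.coprime_one_right q)]
  refine tsum_congr fun k => ?_
  rw [← pow_add, cpow_one]

/-! ## §2. The Euler factor at `q` for `(d,l)` powers of `q`: four cases ((A.5)) -/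

/-- `ξ₁(qʳ; d, l) = κ̃₁(qʳ; d)` for `q ∣ l` ((A.5), case `q ∣ l`; `d, l, r ≥ 1`).
[cite: Zhang2022LandauSiegel, App. A (A.5) p. 103] -/
theorem xi1_prime_pow_of_dvd [NeZero D] {q d l r : ℕ} (hq : q.Prime) (hd : 1 ≤ d) (hl : 1 ≤ l)
    (hr : 1 ≤ r) (hql : q ∣ l) : xi1 c' χ (q ^ r) d l = kappaTilde1 c' χ (q ^ r) d 1 :=
  (Typed.AppendixA1.eqA_5_holds c' D χ q d l r hq hd hl hr).2 hql

/-- `ξ₁(qʳ; d, l) = κ̃₁(qʳ; d) − (χ(q)q/(q−1))κ₁(q^{r−1})` for `(q,l) = 1` ((A.5); `d, l, r ≥ 1`).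
[cite: Zhang2022LandauSiegel, App. A (A.5) p. 103] -/
theorem xi1_prime_pow_of_coprime [NeZero D] {q d l r : ℕ} (hq : q.Prime) (hd : 1 ≤ d) (hl : 1 ≤ l)
    (hr : 1 ≤ r) (hql : Nat.Coprime q l) :
    xi1 c' χ (q ^ r) d l = kappaTilde1 c' χ (q ^ r) d 1 -
      χ (q : ZMod D) * (q : ℂ) / ((q : ℂ) - 1) * kappa1 c' D (q ^ (r - 1)) :=
  (Typed.AppendixA1.eqA_5_holds c' D χ q d l r hq hd hl hr).1 hql

/-- `κ̃₁(qʳ; q) = κ₁(qʳ)`. [cite: Zhang2022LandauSiegel, App. A p. 103] -/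
theorem kappaTilde1_prime_pow_prime [NeZero D] {q : ℕ} (hq : q.Prime) (r : ℕ) :
    kappaTilde1 c' χ (q ^ r) q 1 = kappa1 c' D (q ^ r) := by
  have h := kappaTilde1_prime_pow_prime_pow c' χ hq (le_refl 1) r
  rwa [pow_one] at h

/-- `ξ₁(qʳ; qᵃ, l) = ξ₁(qʳ; q, l)` for `a ≥ 1` (`κ̃₁(qʳ;qᵃ) = κ₁(qʳ) = κ̃₁(qʳ;q)` in both cases of
(A.5)). [cite: Zhang2022LandauSiegel, App. A (A.5) p. 103] -/
theorem xi1_prime_pow_left [NeZero D] {q a l r : ℕ} (hq : q.Prime) (ha : 1 ≤ a) (hl : 1 ≤ l)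
    (hr : 1 ≤ r) : xi1 c' χ (q ^ r) (q ^ a) l = xi1 c' χ (q ^ r) q l := by
  have hqa : 1 ≤ q ^ a := Nat.one_le_pow _ _ hq.pos
  by_cases hql : q ∣ l
  · rw [xi1_prime_pow_of_dvd c' χ hq hqa hl hr hql, xi1_prime_pow_of_dvd c' χ hq hq.one_lt.le hl hr hql,
      kappaTilde1_prime_pow_prime_pow c' χ hq ha r, kappaTilde1_prime_pow_prime c' χ hq r]
  · have hcop : Nat.Coprime q l := (Nat.Prime.coprime_iff_not_dvd hq).mpr hql
    rw [xi1_prime_pow_of_coprime c' χ hq hqa hl hr hcop,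
      xi1_prime_pow_of_coprime c' χ hq hq.one_lt.le hl hr hcop,
      kappaTilde1_prime_pow_prime_pow c' χ hq ha r, kappaTilde1_prime_pow_prime c' χ hq r]

/-- `ξ₁(qʳ; d, qᵇ) = ξ₁(qʳ; d, q)` for `b ≥ 1` (both equal `κ̃₁(qʳ; d)`).
[cite: Zhang2022LandauSiegel, App. A (A.5) p. 103] -/
theorem xi1_prime_pow_right [NeZero D] {q d b r : ℕ} (hq : q.Prime) (hd : 1 ≤ d) (hb : 1 ≤ b)
    (hr : 1 ≤ r) : xi1 c' χ (q ^ r) d (q ^ b) = xi1 c' χ (q ^ r) d q := by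
  rw [xi1_prime_pow_of_dvd c' χ hq hd (Nat.one_le_pow _ _ hq.pos) hr (dvd_pow_self q (by omega)),
    xi1_prime_pow_of_dvd c' χ hq hd hq.one_lt.le hr (dvd_refl q)]

/-- The factor at `q` for `d = qᵃ`, `a ≥ 1`, equals the one for `d = q` (any `l ≥ 1`).
[cite: Zhang2022LandauSiegel, §15 p. 85] -/
theorem calM1Factor_prime_pow_left [NeZero D] {q a l : ℕ} (hq : q.Prime) (ha : 1 ≤ a) (hl : 1 ≤ l)
    (s : ℂ) : calM1Factor c' χ q (q ^ a) l s = calM1Factor c' χ q q l s := by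
  have hS : xi1LocalSeries c' χ q (q ^ a) l s = xi1LocalSeries c' χ q q l s := by
    unfold xi1LocalSeries
    refine tsum_congr fun r => ?_
    rcases Nat.eq_zero_or_pos r with rfl | hr
    · simp
    · rw [if_neg hr.ne', if_neg hr.ne', xi1_prime_pow_left c' χ hq ha hl hr]
  have hlam : lamTilde1 c' χ q (q ^ a) = lamTilde1 c' χ q q := by
    have h1 := lamTilde1_prime_prime_pow c' χ hq (le_refl 1)
    rw [pow_one] at h1
    rw [lamTilde1_prime_prime_pow c' χ hq ha, h1]
  unfold calM1Factor
  rw [hS, hlam]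

/-- The factor at `q` for `l = qᵇ`, `b ≥ 1`, equals the one for `l = q` (any `d ≥ 1`).
[cite: Zhang2022LandauSiegel, §15 p. 85] -/
theorem calM1Factor_prime_pow_right [NeZero D] {q d b : ℕ} (hq : q.Prime) (hd : 1 ≤ d) (hb : 1 ≤ b)
    (s : ℂ) : calM1Factor c' χ q d (q ^ b) s = calM1Factor c' χ q d q s := by
  have hS : xi1LocalSeries c' χ q d (q ^ b) s = xi1LocalSeries c' χ q d q s := by
    unfold xi1LocalSeries
    refine tsum_congr fun r => ?_
    rcases Nat.eq_zero_or_pos r with rfl | hr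
    · simp
    · rw [if_neg hr.ne', if_neg hr.ne', xi1_prime_pow_right c' χ hq hd hb hr]
  unfold calM1Factor
  rw [hS]

/-! ## §3. Summability of the local series and the two (A.5)-differences -/

/-- `Σ_r (r+1)ᵏ θʳ` converges for `0 ≤ θ < 1`. [folklore] -/
private theorem summable_succ_pow_mul_geometric (k : ℕ) {θ : ℝ} (h0 : 0 ≤ θ) (h1 : θ < 1) :
    Summable (fun r : ℕ => ((r : ℝ) + 1) ^ k * θ ^ r) := by
  have h : Summable (fun n : ℕ => (n : ℝ) ^ k * θ ^ n) :=
    summable_pow_mul_geometric_of_norm_lt_one k (by rw [Real.norm_eq_abs, abs_of_nonneg h0]; exact h1)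
  have h2 : Summable (fun n : ℕ => (((n + 1 : ℕ) : ℝ)) ^ k * θ ^ (n + 1)) :=
    (summable_nat_add_iff 1).mpr h
  rcases eq_or_lt_of_le h0 with hz | hpos
  · refine summable_of_ne_finset_zero (s := {0}) fun r hr => ?_
    have hr0 : r ≠ 0 := by simpa using hr
    simp [← hz, zero_pow hr0]
  · refine ((h2.mul_right θ⁻¹)).congr fun n => ?_
    push_cast
    rw [pow_succ, mul_assoc, mul_assoc, mul_inv_cancel₀ hpos.ne', mul_one]

/-- `‖q^{(r:ℂ)s}‖ = (q^{Re s})^r` for a prime `q`. [folklore] -/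
private theorem norm_natCast_cpow_nat_mul {q : ℕ} (hq : q.Prime) (r : ℕ) (s : ℂ) :
    ‖(q : ℂ) ^ ((r : ℂ) * s)‖ = ((q : ℝ) ^ s.re) ^ r := by
  rw [Complex.norm_natCast_cpow_of_pos hq.pos, ← Real.rpow_natCast,
    ← Real.rpow_mul (by exact_mod_cast hq.pos.le)]
  congr 1
  simp [mul_comm]

/-- The terms `ξ₁(qʳ;d,l)q^{−rs}` (`r ≥ 1`) of the local series are absolutely summable for `Re s > 0`
(`|ξ₁(qʳ;d,l)| ≤ 4Z₂(r+1)³`, `Section15B.norm_xi1_prime_pow_le`).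
[cite: Zhang2022LandauSiegel, §15 p. 84] -/
theorem summable_xi1LocalSeries_term {q : ℕ} (hq : q.Prime) (d l : ℕ) {s : ℂ} (hs : 0 < s.re) :
    Summable (fun r : ℕ =>
      if r = 0 then (0 : ℂ) else xi1 c' χ (q ^ r) d l / (q : ℂ) ^ ((r : ℂ) * s)) := by
  set Z₂ : ℝ := ∑' k : ℕ, ((k : ℝ) + 1) ^ 2 * (1 / 2 : ℝ) ^ k with hZ₂
  have hZ₂0 : 0 ≤ Z₂ := tsum_nonneg fun k => by positivity
  have hq0 : (0 : ℝ) < q := by exact_mod_cast hq.pos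
  set θ : ℝ := ((q : ℝ) ^ s.re)⁻¹ with hθ
  have hθ0 : 0 ≤ θ := by positivity
  have hqσ : 1 < (q : ℝ) ^ s.re := Real.one_lt_rpow (by exact_mod_cast hq.one_lt) hs
  have hθ1 : θ < 1 := inv_lt_one_of_one_lt₀ hqσ
  have hmaj := (summable_succ_pow_mul_geometric 3 hθ0 hθ1).mul_left (4 * Z₂)
  refine Summable.of_norm_bounded hmaj fun r => ?_
  split_ifs with hr
  · rw [norm_zero]; positivity
  · rw [norm_div, norm_natCast_cpow_nat_mul hq r s, hθ, inv_pow, div_eq_mul_inv]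
    have h := norm_xi1_prime_pow_le c' χ hq d l r
    have hpos : 0 < (((q : ℝ) ^ s.re) ^ r)⁻¹ := by positivity
    calc ‖xi1 c' χ (q ^ r) d l‖ * (((q : ℝ) ^ s.re) ^ r)⁻¹
        ≤ (4 * Z₂ * ((r : ℝ) + 1) ^ 3) * (((q : ℝ) ^ s.re) ^ r)⁻¹ :=
          mul_le_mul_of_nonneg_right h hpos.le
      _ = 4 * Z₂ * (((r : ℝ) + 1) ^ 3 * (((q : ℝ) ^ s.re) ^ r)⁻¹) := by ring

/-- **First (A.5)-difference**: for `d, l-side` — `Σ_{r≥1} ξ₁(qʳ;d,q)q^{−rs} − Σ_{r≥1} ξ₁(qʳ;d,1)q^{−rs}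
= Σ_{r≥1} (χ(q)q/(q−1))κ₁(q^{r−1})q^{−rs}` (`d ≥ 1`, `Re s > 0`); in particular the difference does
not depend on `d`. [cite: Zhang2022LandauSiegel, App. A (A.5) p. 103] -/
theorem xi1LocalSeries_prime_right_sub [NeZero D] {q d : ℕ} (hq : q.Prime) (hd : 1 ≤ d) {s : ℂ}
    (hs : 0 < s.re) :
    xi1LocalSeries c' χ q d q s - xi1LocalSeries c' χ q d 1 s =
      ∑' r : ℕ, if r = 0 then (0 : ℂ) else
        χ (q : ZMod D) * (q : ℂ) / ((q : ℂ) - 1) * kappa1 c' D (q ^ (r - 1)) /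
          (q : ℂ) ^ ((r : ℂ) * s) := by
  unfold xi1LocalSeries
  rw [← Summable.tsum_sub (summable_xi1LocalSeries_term c' χ hq d q hs)
    (summable_xi1LocalSeries_term c' χ hq d 1 hs)]
  refine tsum_congr fun r => ?_
  rcases Nat.eq_zero_or_pos r with rfl | hr
  · simp
  · rw [if_neg hr.ne', if_neg hr.ne', if_neg hr.ne',
      xi1_prime_pow_of_dvd c' χ hq hd hq.one_lt.le hr (dvd_refl q),
      xi1_prime_pow_of_coprime c' χ hq hd le_rfl hr (Nat.coprime_one_right q)]
    ring

/-- **Second (A.5)-difference**: `Σ_{r≥1} ξ₁(qʳ;q,1)q^{−rs} − Σ_{r≥1} ξ₁(qʳ;1,1)q^{−rs}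
= Σ_{r≥1} (κ₁(qʳ) − κ̃₁(qʳ;1))q^{−rs}` (`κ̃₁(qʳ;q) = κ₁(qʳ)`, u020; `Re s > 0`).
[cite: Zhang2022LandauSiegel, App. A (A.5) p. 103] -/
theorem xi1LocalSeries_prime_left_sub [NeZero D] {q : ℕ} (hq : q.Prime) {s : ℂ} (hs : 0 < s.re) :
    xi1LocalSeries c' χ q q 1 s - xi1LocalSeries c' χ q 1 1 s =
      ∑' r : ℕ, if r = 0 then (0 : ℂ) else
        (kappa1 c' D (q ^ r) - kappaTilde1 c' χ (q ^ r) 1 1) / (q : ℂ) ^ ((r : ℂ) * s) := by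
  unfold xi1LocalSeries
  rw [← Summable.tsum_sub (summable_xi1LocalSeries_term c' χ hq q 1 hs)
    (summable_xi1LocalSeries_term c' χ hq 1 1 hs)]
  refine tsum_congr fun r => ?_
  rcases Nat.eq_zero_or_pos r with rfl | hr
  · simp
  · rw [if_neg hr.ne', if_neg hr.ne', if_neg hr.ne',
      xi1_prime_pow_of_coprime c' χ hq hq.one_lt.le le_rfl hr (Nat.coprime_one_right q),
      xi1_prime_pow_of_coprime c' χ hq le_rfl le_rfl hr (Nat.coprime_one_right q),
      kappaTilde1_prime_pow_prime c' χ hq r]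
    ring

/-! ## §4. The three differences of Euler factors at `q` -/

/-- **`F_q(1,q;s) − F_q(1,1;s) = Z_q(s)·λ₁(q)·Σ_{r≥1}(χ(q)q/(q−1))κ₁(q^{r−1})q^{−rs}`** (`Re s > 0`;
`Z_q` the zeta-quotient prefactor, `λ̃₁(q,1) = λ₁(q)`). [cite: Zhang2022LandauSiegel, §15 p. 85] -/
theorem calM1Factor_one_prime_sub [NeZero D] {q : ℕ} (hq : q.Prime) {s : ℂ} (hs : 0 < s.re) :
    calM1Factor c' χ q 1 q s - calM1Factor c' χ q 1 1 s =
      (1 - (q : ℂ) ^ (-(s + Skeleton.beta1 c' D))) * (1 - (q : ℂ) ^ (-(s + Skeleton.beta2 c' D))) /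
        ((1 - (q : ℂ) ^ (-s)) * (1 - χ (q : ZMod D) * (q : ℂ) ^ (-s))) *
      (lam1 c' χ q 1 *
        ∑' r : ℕ, if r = 0 then (0 : ℂ) else
          χ (q : ZMod D) * (q : ℂ) / ((q : ℂ) - 1) * kappa1 c' D (q ^ (r - 1)) /
            (q : ℂ) ^ ((r : ℂ) * s)) := by
  rw [← xi1LocalSeries_prime_right_sub c' χ hq le_rfl hs, ← lamTilde1_prime_one_eq c' χ hq]
  unfold calM1Factor
  ring

/-- **`λ₁(q)F_q(q,1;s) − F_q(1,1;s) = Z_q(s)·[(λ₁(q) − 1) + λ₁(q)Σ_{r≥1}(κ₁(qʳ) − κ̃₁(qʳ;1))q^{−rs}]`**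
(`Re s > 0`; `λ̃₁(q,q) = 1`, `λ̃₁(q,1) = λ₁(q)`). [cite: Zhang2022LandauSiegel, §15 p. 85] -/
theorem lam_mul_calM1Factor_prime_one_sub [NeZero D] {q : ℕ} (hq : q.Prime) {s : ℂ}
    (hs : 0 < s.re) :
    lam1 c' χ q 1 * calM1Factor c' χ q q 1 s - calM1Factor c' χ q 1 1 s =
      (1 - (q : ℂ) ^ (-(s + Skeleton.beta1 c' D))) * (1 - (q : ℂ) ^ (-(s + Skeleton.beta2 c' D))) /
        ((1 - (q : ℂ) ^ (-s)) * (1 - χ (q : ZMod D) * (q : ℂ) ^ (-s))) *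
      ((lam1 c' χ q 1 - 1) + lam1 c' χ q 1 *
        ∑' r : ℕ, if r = 0 then (0 : ℂ) else
          (kappa1 c' D (q ^ r) - kappaTilde1 c' χ (q ^ r) 1 1) / (q : ℂ) ^ ((r : ℂ) * s)) := by
  have h1 := lamTilde1_prime_prime_pow c' χ hq (le_refl 1)
  rw [pow_one] at h1
  rw [← xi1LocalSeries_prime_left_sub c' χ hq hs, ← lamTilde1_prime_one_eq c' χ hq]
  unfold calM1Factor
  rw [h1]
  ring

/-- **`λ₁(q)F_q(q,q;s) − F_q(1,1;s) = [F_q(1,q;s) − F_q(1,1;s)] + [λ₁(q)F_q(q,1;s) − F_q(1,1;s)]`**: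
the `l`-effect `F_q(d,q;s) − F_q(d,1;s)` of (A.5) is the same for `d = q` (weight `λ̃₁(q,q) = 1`,
times the outer `λ₁(q)`) and for `d = 1` (weight `λ̃₁(q,1) = λ₁(q)`) (`Re s > 0`).
[cite: Zhang2022LandauSiegel, App. A (A.5) p. 103] -/
theorem lam_mul_calM1Factor_prime_prime_sub [NeZero D] {q : ℕ} (hq : q.Prime) {s : ℂ}
    (hs : 0 < s.re) :
    lam1 c' χ q 1 * calM1Factor c' χ q q q s - calM1Factor c' χ q 1 1 s =
      (calM1Factor c' χ q 1 q s - calM1Factor c' χ q 1 1 s) +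
        (lam1 c' χ q 1 * calM1Factor c' χ q q 1 s - calM1Factor c' χ q 1 1 s) := by
  have h1 := lamTilde1_prime_prime_pow c' χ hq (le_refl 1)
  rw [pow_one] at h1
  have hq1 := xi1LocalSeries_prime_right_sub c' χ hq hq.one_lt.le hs
  have h11 := xi1LocalSeries_prime_right_sub c' χ hq le_rfl hs
  -- `S(q,q) − S(q,1) = S(1,q) − S(1,1)`
  have hdiff : xi1LocalSeries c' χ q q q s - xi1LocalSeries c' χ q q 1 s =
      xi1LocalSeries c' χ q 1 q s - xi1LocalSeries c' χ q 1 1 s := by rw [hq1, h11]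
  have hlam1 := lamTilde1_prime_one_eq c' χ hq
  unfold calM1Factor
  rw [h1, hlam1]
  have e : xi1LocalSeries c' χ q q q s =
      xi1LocalSeries c' χ q q 1 s + (xi1LocalSeries c' χ q 1 q s - xi1LocalSeries c' χ q 1 1 s) := by
    rw [← hdiff]; ring
  rw [e]
  ring

/-! ## §5. Bounds on the line `Re s = 1` (where `s = 1 − βⱼ` lives) -/

/-- `‖χ(q)q/(q−1)‖ ≤ 2` for a prime `q`. [cite: Zhang2022LandauSiegel, App. A (A.5) p. 103] -/
theorem norm_chi_mul_div_sub_one_le {q : ℕ} (hq : q.Prime) :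
    ‖χ (q : ZMod D) * (q : ℂ) / ((q : ℂ) - 1)‖ ≤ 2 := by
  have hq2 : (2 : ℝ) ≤ q := by exact_mod_cast hq.two_le
  have hχ : ‖χ (q : ZMod D)‖ ≤ 1 := χ.norm_le_one _
  have hden : ‖(q : ℂ) - 1‖ = (q : ℝ) - 1 := by
    have : (q : ℂ) - 1 = (((q : ℝ) - 1 : ℝ) : ℂ) := by push_cast; ring
    rw [this, Complex.norm_real, Real.norm_eq_abs, abs_of_pos (by linarith)]
  rw [norm_div, norm_mul, Complex.norm_natCast, hden, div_le_iff₀ (by linarith)]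
  nlinarith

/-- On `Re s = 1`: `‖q^{(r:ℂ)s}‖ = qʳ`. [folklore] -/
private theorem norm_cpow_nat_mul_of_re_one {q : ℕ} (hq : q.Prime) (r : ℕ) {s : ℂ} (hs : s.re = 1) :
    ‖(q : ℂ) ^ ((r : ℂ) * s)‖ = (q : ℝ) ^ r := by
  rw [norm_natCast_cpow_nat_mul hq r s, hs, Real.rpow_one]

/-- **`‖Σ_{r≥1}(χ(q)q/(q−1))κ₁(q^{r−1})q^{−rs}‖ ≤ 2Z₂/q`** on `Re s = 1`, `Z₂ = Σ_m (m+1)²2^{−m}`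
(`|κ₁(qᵐ)| ≤ (m+1)²`). [cite: Zhang2022LandauSiegel, App. A p. 105] -/
theorem norm_tsum_right_diff_le {q : ℕ} (hq : q.Prime) {s : ℂ} (hs : s.re = 1) :
    ‖∑' r : ℕ, if r = 0 then (0 : ℂ) else
        χ (q : ZMod D) * (q : ℂ) / ((q : ℂ) - 1) * kappa1 c' D (q ^ (r - 1)) /
          (q : ℂ) ^ ((r : ℂ) * s)‖ ≤
      2 * (∑' m : ℕ, ((m : ℝ) + 1) ^ 2 * (1 / 2 : ℝ) ^ m) / q := by
  set Z₂ : ℝ := ∑' m : ℕ, ((m : ℝ) + 1) ^ 2 * (1 / 2 : ℝ) ^ m with hZ₂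
  have hq0 : (0 : ℝ) < q := by exact_mod_cast hq.pos
  have hq2 : (2 : ℝ) ≤ q := by exact_mod_cast hq.two_le
  have hsumZ : Summable (fun m : ℕ => ((m : ℝ) + 1) ^ 2 * (1 / 2 : ℝ) ^ m) :=
    summable_succ_pow_mul_geometric 2 (by norm_num) (by norm_num)
  -- termwise bound by `g r := 2 (r'+1)² (1/2)^{r'} / q` with `r = r' + 1`, i.e. shift
  set f : ℕ → ℂ := fun r => if r = 0 then (0 : ℂ) else
      χ (q : ZMod D) * (q : ℂ) / ((q : ℂ) - 1) * kappa1 c' D (q ^ (r - 1)) /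
        (q : ℂ) ^ ((r : ℂ) * s) with hf
  set g : ℕ → ℝ := fun m => 2 / q * (((m : ℝ) + 1) ^ 2 * (1 / 2 : ℝ) ^ m) with hg
  have hgsum : Summable g := hsumZ.mul_left _
  have hf0 : f 0 = 0 := by simp [hf]
  -- `‖f (m+1)‖ ≤ g m`
  have hfg : ∀ m : ℕ, ‖f (m + 1)‖ ≤ g m := by
    intro m
    have hm : m + 1 ≠ 0 := by omega
    simp only [hf, hg, if_neg hm, Nat.add_sub_cancel]
    rw [norm_div, norm_mul, norm_cpow_nat_mul_of_re_one hq (m + 1) hs]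
    have hκ : ‖kappa1 c' D (q ^ m)‖ ≤ ((m : ℝ) + 1) ^ 2 := by
      unfold kappa1; exact MeanSquareMajorant.norm_kappa₁_prime_pow_le _ _ hq m
    have hc := norm_chi_mul_div_sub_one_le χ hq
    have hqm : (0 : ℝ) < (q : ℝ) ^ (m + 1) := by positivity
    rw [div_le_iff₀ hqm]
    have hhalf : ((q : ℝ) ^ m)⁻¹ ≤ (1 / 2 : ℝ) ^ m := by
      rw [← inv_pow, one_div]; exact pow_le_pow_left₀ (by positivity) (inv_anti₀ (by norm_num) hq2) m
    calc ‖χ (q : ZMod D) * (q : ℂ) / ((q : ℂ) - 1)‖ * ‖kappa1 c' D (q ^ m)‖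
        ≤ 2 * ((m : ℝ) + 1) ^ 2 := mul_le_mul hc hκ (norm_nonneg _) (by norm_num)
      _ = 2 * ((m : ℝ) + 1) ^ 2 * ((q : ℝ) ^ m)⁻¹ * (q : ℝ) ^ m := by
          rw [mul_assoc (2 * ((m : ℝ) + 1) ^ 2), inv_mul_cancel₀ (by positivity), mul_one]
      _ ≤ 2 * ((m : ℝ) + 1) ^ 2 * (1 / 2 : ℝ) ^ m * (q : ℝ) ^ m := by gcongr
      _ = 2 / q * (((m : ℝ) + 1) ^ 2 * (1 / 2 : ℝ) ^ m) * (q : ℝ) ^ (m + 1) := by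
          field_simp; ring
  have hfsum : Summable f := by
    have h1 : Summable (fun m => f (m + 1)) :=
      Summable.of_norm_bounded hgsum (fun m => by simpa using hfg m)
    exact (summable_nat_add_iff 1).mp h1
  rw [hfsum.tsum_eq_zero_add, hf0, zero_add]
  calc ‖∑' m, f (m + 1)‖ ≤ ∑' m, ‖f (m + 1)‖ := norm_tsum_le_tsum_norm
        ((summable_nat_add_iff 1).mpr hfsum).norm
    _ ≤ ∑' m, g m := ((summable_nat_add_iff 1).mpr hfsum).norm.tsum_le_tsum hfg hgsum
    _ = 2 / q * Z₂ := by rw [hg, tsum_mul_left]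
    _ = 2 * Z₂ / q := by ring

/-- **`κ̃₁(qʳ;1) − κ₁(qʳ) = Σ_{k≥0} κ₁(q^{r+k+1})χ(q^{k+1})q^{−(k+1)}`** (`r ≥ 1`): the `k = 0` term of
(15.9) at a prime power is `κ₁(qʳ)`. [cite: Zhang2022LandauSiegel, §15 (15.9) p. 82] -/
theorem kappaTilde1_sub_kappa1_eq_tsum {q r : ℕ} (hq : q.Prime) (hr : 1 ≤ r) :
    kappaTilde1 c' χ (q ^ r) 1 1 - kappa1 c' D (q ^ r) =
      ∑' k : ℕ, kappa1 c' D (q ^ (r + (k + 1))) * χ ((q ^ (k + 1) : ℕ) : ZMod D) /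
        ((q ^ (k + 1) : ℕ) : ℂ) := by
  have hq2 : (2 : ℝ) ≤ q := by exact_mod_cast hq.two_le
  set f : ℕ → ℂ := fun k => kappa1 c' D (q ^ (r + k)) * χ ((q ^ k : ℕ) : ZMod D) /
    ((q ^ k : ℕ) : ℂ) with hf
  have hfb : ∀ k, ‖f k‖ ≤ ((r : ℝ) + 1) ^ 2 * (((k : ℝ) + 1) ^ 2 * (1 / 2 : ℝ) ^ k) := by
    intro k
    simp only [hf]
    rw [norm_div, norm_mul]
    have hκ : ‖kappa1 c' D (q ^ (r + k))‖ ≤ (((r + k : ℕ) : ℝ) + 1) ^ 2 := by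
      unfold kappa1; exact MeanSquareMajorant.norm_kappa₁_prime_pow_le _ _ hq (r + k)
    have hχ : ‖χ ((q ^ k : ℕ) : ZMod D)‖ ≤ 1 := χ.norm_le_one _
    have hqk : ‖((q ^ k : ℕ) : ℂ)‖ = (q : ℝ) ^ k := by rw [Complex.norm_natCast]; push_cast; ring
    rw [hqk, div_le_iff₀ (by positivity)]
    have hhalf : ((q : ℝ) ^ k)⁻¹ ≤ (1 / 2 : ℝ) ^ k := by
      rw [← inv_pow, one_div]; exact pow_le_pow_left₀ (by positivity) (inv_anti₀ (by norm_num) hq2) k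
    have hrk : (((r + k : ℕ) : ℝ) + 1) ^ 2 ≤ ((r : ℝ) + 1) ^ 2 * ((k : ℝ) + 1) ^ 2 := by
      rw [← mul_pow]; push_cast
      exact pow_le_pow_left₀ (by positivity) (by nlinarith [(Nat.cast_nonneg r : (0:ℝ) ≤ r),
        (Nat.cast_nonneg k : (0:ℝ) ≤ k)]) 2
    calc ‖kappa1 c' D (q ^ (r + k))‖ * ‖χ ((q ^ k : ℕ) : ZMod D)‖
        ≤ (((r + k : ℕ) : ℝ) + 1) ^ 2 * 1 := mul_le_mul hκ hχ (norm_nonneg _) (by positivity)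
      _ ≤ ((r : ℝ) + 1) ^ 2 * ((k : ℝ) + 1) ^ 2 := by rw [mul_one]; exact hrk
      _ = ((r : ℝ) + 1) ^ 2 * ((k : ℝ) + 1) ^ 2 * (((q : ℝ) ^ k)⁻¹ * (q : ℝ) ^ k) := by
          rw [inv_mul_cancel₀ (by positivity), mul_one]
      _ ≤ ((r : ℝ) + 1) ^ 2 * ((k : ℝ) + 1) ^ 2 * ((1 / 2 : ℝ) ^ k * (q : ℝ) ^ k) := by gcongr
      _ = ((r : ℝ) + 1) ^ 2 * (((k : ℝ) + 1) ^ 2 * (1 / 2 : ℝ) ^ k) * (q : ℝ) ^ k := by ring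
  have hfsum : Summable f := Summable.of_norm_bounded
    ((summable_succ_pow_mul_geometric 2 (by norm_num) (by norm_num)).mul_left _) hfb
  rw [kappaTilde1_prime_pow_one_eq_tsum c' χ hq hr]
  change ∑' k, f k - kappa1 c' D (q ^ r) = ∑' k, f (k + 1)
  rw [hfsum.tsum_eq_zero_add]
  have hf0 : f 0 = kappa1 c' D (q ^ r) := by simp [hf]
  rw [hf0]; ring

/-- **`‖κ̃₁(qʳ;1) − κ₁(qʳ)‖ ≤ W(r+1)²/q`**, `W = Σ_m (m+2)²2^{−m}` (`r ≥ 1`).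
[cite: Zhang2022LandauSiegel, §15 (15.9) p. 82] -/
theorem norm_kappaTilde1_sub_kappa1_le {q r : ℕ} (hq : q.Prime) (hr : 1 ≤ r) :
    ‖kappaTilde1 c' χ (q ^ r) 1 1 - kappa1 c' D (q ^ r)‖ ≤
      (∑' m : ℕ, ((m : ℝ) + 2) ^ 2 * (1 / 2 : ℝ) ^ m) * ((r : ℝ) + 1) ^ 2 / q := by
  have hq0 : (0 : ℝ) < q := by exact_mod_cast hq.pos
  have hq2 : (2 : ℝ) ≤ q := by exact_mod_cast hq.two_le
  set W : ℝ := ∑' m : ℕ, ((m : ℝ) + 2) ^ 2 * (1 / 2 : ℝ) ^ m with hW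
  have hWsum : Summable (fun m : ℕ => ((m : ℝ) + 2) ^ 2 * (1 / 2 : ℝ) ^ m) := by
    have h := summable_succ_pow_mul_geometric 2 (θ := 1 / 2) (by norm_num) (by norm_num)
    have h2 := (summable_nat_add_iff 1).mpr h
    refine (h2.mul_left 2).congr fun m => ?_
    push_cast
    rw [pow_succ]; ring
  rw [kappaTilde1_sub_kappa1_eq_tsum c' χ hq hr]
  set f : ℕ → ℂ := fun k => kappa1 c' D (q ^ (r + (k + 1))) * χ ((q ^ (k + 1) : ℕ) : ZMod D) /
    ((q ^ (k + 1) : ℕ) : ℂ) with hf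
  set g : ℕ → ℝ := fun k => ((r : ℝ) + 1) ^ 2 / q * (((k : ℝ) + 2) ^ 2 * (1 / 2 : ℝ) ^ k) with hg
  have hgsum : Summable g := hWsum.mul_left _
  have hfg : ∀ k, ‖f k‖ ≤ g k := by
    intro k
    simp only [hf, hg]
    rw [norm_div, norm_mul]
    have hκ : ‖kappa1 c' D (q ^ (r + (k + 1)))‖ ≤ (((r + (k + 1) : ℕ) : ℝ) + 1) ^ 2 := by
      unfold kappa1; exact MeanSquareMajorant.norm_kappa₁_prime_pow_le _ _ hq _
    have hχ : ‖χ ((q ^ (k + 1) : ℕ) : ZMod D)‖ ≤ 1 := χ.norm_le_one _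
    have hqk : ‖((q ^ (k + 1) : ℕ) : ℂ)‖ = (q : ℝ) ^ (k + 1) := by
      rw [Complex.norm_natCast]; push_cast; ring
    rw [hqk, div_le_iff₀ (by positivity)]
    have hhalf : ((q : ℝ) ^ k)⁻¹ ≤ (1 / 2 : ℝ) ^ k := by
      rw [← inv_pow, one_div]; exact pow_le_pow_left₀ (by positivity) (inv_anti₀ (by norm_num) hq2) k
    have hrk : (((r + (k + 1) : ℕ) : ℝ) + 1) ^ 2 ≤ ((r : ℝ) + 1) ^ 2 * ((k : ℝ) + 2) ^ 2 := by
      rw [← mul_pow]; push_cast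
      exact pow_le_pow_left₀ (by positivity) (by nlinarith [(Nat.cast_nonneg r : (0:ℝ) ≤ r),
        (Nat.cast_nonneg k : (0:ℝ) ≤ k)]) 2
    calc ‖kappa1 c' D (q ^ (r + (k + 1)))‖ * ‖χ ((q ^ (k + 1) : ℕ) : ZMod D)‖
        ≤ (((r + (k + 1) : ℕ) : ℝ) + 1) ^ 2 * 1 := mul_le_mul hκ hχ (norm_nonneg _) (by positivity)
      _ ≤ ((r : ℝ) + 1) ^ 2 * ((k : ℝ) + 2) ^ 2 := by rw [mul_one]; exact hrk
      _ = ((r : ℝ) + 1) ^ 2 * ((k : ℝ) + 2) ^ 2 * (((q : ℝ) ^ k)⁻¹ * (q : ℝ) ^ k) := by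
          rw [inv_mul_cancel₀ (by positivity), mul_one]
      _ ≤ ((r : ℝ) + 1) ^ 2 * ((k : ℝ) + 2) ^ 2 * ((1 / 2 : ℝ) ^ k * (q : ℝ) ^ k) := by gcongr
      _ = ((r : ℝ) + 1) ^ 2 / q * (((k : ℝ) + 2) ^ 2 * (1 / 2 : ℝ) ^ k) * (q : ℝ) ^ (k + 1) := by
          field_simp; ring
  have hfsum : Summable f := Summable.of_norm_bounded hgsum hfg
  calc ‖∑' k, f k‖ ≤ ∑' k, ‖f k‖ := norm_tsum_le_tsum_norm hfsum.norm
    _ ≤ ∑' k, g k := hfsum.norm.tsum_le_tsum hfg hgsum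
    _ = ((r : ℝ) + 1) ^ 2 / q * W := by rw [hg, tsum_mul_left]
    _ = W * ((r : ℝ) + 1) ^ 2 / q := by ring

/-- **`‖Σ_{r≥1}(κ₁(qʳ) − κ̃₁(qʳ;1))q^{−rs}‖ ≤ W²/q²`** on `Re s = 1` (`W = Σ_m (m+2)²2^{−m}`).
[cite: Zhang2022LandauSiegel, App. A p. 105] -/
theorem norm_tsum_left_diff_le {q : ℕ} (hq : q.Prime) {s : ℂ} (hs : s.re = 1) :
    ‖∑' r : ℕ, if r = 0 then (0 : ℂ) else
        (kappa1 c' D (q ^ r) - kappaTilde1 c' χ (q ^ r) 1 1) / (q : ℂ) ^ ((r : ℂ) * s)‖ ≤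
      (∑' m : ℕ, ((m : ℝ) + 2) ^ 2 * (1 / 2 : ℝ) ^ m) ^ 2 / (q : ℝ) ^ 2 := by
  have hq0 : (0 : ℝ) < q := by exact_mod_cast hq.pos
  have hq2 : (2 : ℝ) ≤ q := by exact_mod_cast hq.two_le
  set W : ℝ := ∑' m : ℕ, ((m : ℝ) + 2) ^ 2 * (1 / 2 : ℝ) ^ m with hW
  have hWsum : Summable (fun m : ℕ => ((m : ℝ) + 2) ^ 2 * (1 / 2 : ℝ) ^ m) := by
    have h := summable_succ_pow_mul_geometric 2 (θ := 1 / 2) (by norm_num) (by norm_num)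
    have h2 := (summable_nat_add_iff 1).mpr h
    refine (h2.mul_left 2).congr fun m => ?_
    push_cast
    rw [pow_succ]; ring
  have hW0 : 0 ≤ W := tsum_nonneg fun m => by positivity
  set f : ℕ → ℂ := fun r => if r = 0 then (0 : ℂ) else
      (kappa1 c' D (q ^ r) - kappaTilde1 c' χ (q ^ r) 1 1) / (q : ℂ) ^ ((r : ℂ) * s) with hf
  set g : ℕ → ℝ := fun m => W / (q : ℝ) ^ 2 * (((m : ℝ) + 2) ^ 2 * (1 / 2 : ℝ) ^ m) with hg
  have hgsum : Summable g := hWsum.mul_left _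
  have hf0 : f 0 = 0 := by simp [hf]
  have hfg : ∀ m : ℕ, ‖f (m + 1)‖ ≤ g m := by
    intro m
    have hm : m + 1 ≠ 0 := by omega
    simp only [hf, hg, if_neg hm]
    rw [norm_div, norm_cpow_nat_mul_of_re_one hq (m + 1) hs, norm_sub_rev]
    have hκ := norm_kappaTilde1_sub_kappa1_le c' χ hq (r := m + 1) (by omega)
    rw [div_le_iff₀ (by positivity)]
    have hhalf : ((q : ℝ) ^ m)⁻¹ ≤ (1 / 2 : ℝ) ^ m := by
      rw [← inv_pow, one_div]; exact pow_le_pow_left₀ (by positivity) (inv_anti₀ (by norm_num) hq2) m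
    calc ‖kappaTilde1 c' χ (q ^ (m + 1)) 1 1 - kappa1 c' D (q ^ (m + 1))‖
        ≤ W * (((m + 1 : ℕ) : ℝ) + 1) ^ 2 / q := hκ
      _ = W * ((m : ℝ) + 2) ^ 2 / q * (((q : ℝ) ^ m)⁻¹ * (q : ℝ) ^ m) := by
          rw [inv_mul_cancel₀ (by positivity), mul_one]; push_cast; ring
      _ ≤ W * ((m : ℝ) + 2) ^ 2 / q * ((1 / 2 : ℝ) ^ m * (q : ℝ) ^ m) := by gcongr
      _ = W / (q : ℝ) ^ 2 * (((m : ℝ) + 2) ^ 2 * (1 / 2 : ℝ) ^ m) * (q : ℝ) ^ (m + 1) := by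
          field_simp; ring
  have hfsum : Summable f := by
    have h1 : Summable (fun m => f (m + 1)) :=
      Summable.of_norm_bounded hgsum (fun m => by simpa using hfg m)
    exact (summable_nat_add_iff 1).mp h1
  rw [hfsum.tsum_eq_zero_add, hf0, zero_add]
  calc ‖∑' m, f (m + 1)‖ ≤ ∑' m, ‖f (m + 1)‖ := norm_tsum_le_tsum_norm
        ((summable_nat_add_iff 1).mpr hfsum).norm
    _ ≤ ∑' m, g m := ((summable_nat_add_iff 1).mpr hfsum).norm.tsum_le_tsum hfg hgsum
    _ = W / (q : ℝ) ^ 2 * W := by rw [hg, tsum_mul_left]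
    _ = W ^ 2 / (q : ℝ) ^ 2 := by ring

/-- **`‖Z_q(s)‖ ≤ 9`** on `Re s = 1`: numerator factors `≤ 1 + 1/q ≤ 3/2`, denominator factors
`≥ 1 − 1/q ≥ 1/2`. [cite: Zhang2022LandauSiegel, §15 p. 84] -/
theorem norm_zetaPrefactor_le {q : ℕ} (hq : q.Prime) {s : ℂ} (hs : s.re = 1) :
    ‖(1 - (q : ℂ) ^ (-(s + Skeleton.beta1 c' D))) * (1 - (q : ℂ) ^ (-(s + Skeleton.beta2 c' D))) /
      ((1 - (q : ℂ) ^ (-s)) * (1 - χ (q : ZMod D) * (q : ℂ) ^ (-s)))‖ ≤ 9 := by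
  have hq2 : (2 : ℝ) ≤ q := by exact_mod_cast hq.two_le
  have hnorm : ∀ w : ℂ, w.re = 1 → ‖(q : ℂ) ^ (-w)‖ = (q : ℝ)⁻¹ := by
    intro w hw
    rw [Complex.norm_natCast_cpow_of_pos hq.pos, Complex.neg_re, hw, Real.rpow_neg_one]
  have hqinv : (q : ℝ)⁻¹ ≤ 1 / 2 := by rw [one_div]; exact inv_anti₀ (by norm_num) hq2
  have hb1 : (s + Skeleton.beta1 c' D).re = 1 := by rw [Complex.add_re, beta1_eq_b1_mul_I, hs]; simp
  have hb2 : (s + Skeleton.beta2 c' D).re = 1 := by rw [Complex.add_re, beta2_eq_b2_mul_I, hs]; simp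
  have hnum : ∀ w : ℂ, w.re = 1 → ‖1 - (q : ℂ) ^ (-w)‖ ≤ 3 / 2 := by
    intro w hw
    calc ‖1 - (q : ℂ) ^ (-w)‖ ≤ ‖(1 : ℂ)‖ + ‖(q : ℂ) ^ (-w)‖ := norm_sub_le _ _
      _ ≤ 1 + 1 / 2 := by rw [norm_one, hnorm w hw]; gcongr
      _ = 3 / 2 := by norm_num
  have hden : ∀ (v w : ℂ), ‖v‖ ≤ 1 → w.re = 1 → 1 / 2 ≤ ‖1 - v * (q : ℂ) ^ (-w)‖ := by
    intro v w hv hw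
    have h1 : ‖v * (q : ℂ) ^ (-w)‖ ≤ 1 / 2 := by
      rw [norm_mul, hnorm w hw]
      calc ‖v‖ * (q : ℝ)⁻¹ ≤ 1 * (1 / 2) := by gcongr
        _ = 1 / 2 := one_mul _
    have := norm_sub_norm_le (1 : ℂ) (v * (q : ℂ) ^ (-w))
    rw [norm_one] at this
    linarith
  rw [norm_div, norm_mul, norm_mul]
  have hd1 := hden 1 s (by simp) hs
  have hd2 := hden (χ (q : ZMod D)) s (χ.norm_le_one _) hs
  rw [one_mul] at hd1
  have hdpos : 0 < ‖1 - (q : ℂ) ^ (-s)‖ * ‖1 - χ (q : ZMod D) * (q : ℂ) ^ (-s)‖ := by positivity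
  rw [div_le_iff₀ hdpos]
  have hn1 := hnum _ hb1
  have hn2 := hnum _ hb2
  calc ‖1 - (q : ℂ) ^ (-(s + Skeleton.beta1 c' D))‖ * ‖1 - (q : ℂ) ^ (-(s + Skeleton.beta2 c' D))‖
      ≤ (3 / 2) * (3 / 2) := mul_le_mul hn1 hn2 (norm_nonneg _) (by norm_num)
    _ ≤ 9 * ((1 / 2) * (1 / 2)) := by norm_num
    _ ≤ 9 * (‖1 - (q : ℂ) ^ (-s)‖ * ‖1 - χ (q : ZMod D) * (q : ℂ) ^ (-s)‖) := by
        gcongr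

/-- **`‖F_q(1,q;s) − F_q(1,1;s)‖ ≤ 90Z₂/q`** on `Re s = 1` (`|Z_q| ≤ 9`, `|λ₁(q)| ≤ 5`, the `r`-sum
`≤ 2Z₂/q`). [cite: Zhang2022LandauSiegel, App. A p. 105] -/
theorem norm_calM1Factor_one_prime_sub_le [NeZero D] {q : ℕ} (hq : q.Prime) {s : ℂ} (hs : s.re = 1) :
    ‖calM1Factor c' χ q 1 q s - calM1Factor c' χ q 1 1 s‖ ≤
      90 * (∑' m : ℕ, ((m : ℝ) + 1) ^ 2 * (1 / 2 : ℝ) ^ m) / q := by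
  set Z₂ : ℝ := ∑' m : ℕ, ((m : ℝ) + 1) ^ 2 * (1 / 2 : ℝ) ^ m with hZ₂
  have hZ₂0 : 0 ≤ Z₂ := tsum_nonneg fun m => by positivity
  have hq0 : (0 : ℝ) < q := by exact_mod_cast hq.pos
  have hs0 : 0 < s.re := by rw [hs]; norm_num
  rw [calM1Factor_one_prime_sub c' χ hq hs0, norm_mul, norm_mul]
  have hZ := norm_zetaPrefactor_le c' χ hq hs
  have hlam := norm_lam1_prime_one_le c' χ hq
  have hT := norm_tsum_right_diff_le c' χ hq hs
  calc _ ≤ 9 * (5 * (2 * Z₂ / q)) := by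
        refine mul_le_mul hZ (mul_le_mul hlam hT (norm_nonneg _) (by norm_num)) (by positivity)
          (by norm_num)
    _ = 90 * Z₂ / q := by ring

/-- **`‖λ₁(q)F_q(q,1;s) − F_q(1,1;s)‖ ≤ (72 + 45W²)/q`** on `Re s = 1` (`|Z_q| ≤ 9`,
`|λ₁(q) − 1| ≤ 8/q`, `|λ₁(q)| ≤ 5`, the `r`-sum `≤ W²/q² ≤ W²/q`).
[cite: Zhang2022LandauSiegel, App. A p. 105] -/
theorem norm_lam_mul_calM1Factor_prime_one_sub_le [NeZero D] {q : ℕ} (hq : q.Prime) {s : ℂ}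
    (hs : s.re = 1) :
    ‖lam1 c' χ q 1 * calM1Factor c' χ q q 1 s - calM1Factor c' χ q 1 1 s‖ ≤
      (72 + 45 * (∑' m : ℕ, ((m : ℝ) + 2) ^ 2 * (1 / 2 : ℝ) ^ m) ^ 2) / q := by
  set W : ℝ := ∑' m : ℕ, ((m : ℝ) + 2) ^ 2 * (1 / 2 : ℝ) ^ m with hW
  have hq0 : (0 : ℝ) < q := by exact_mod_cast hq.pos
  have hq1 : (1 : ℝ) ≤ q := by exact_mod_cast hq.one_lt.le
  have hs0 : 0 < s.re := by rw [hs]; norm_num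
  rw [lam_mul_calM1Factor_prime_one_sub c' χ hq hs0, norm_mul]
  have hZ := norm_zetaPrefactor_le c' χ hq hs
  have hlam := norm_lam1_prime_one_le c' χ hq
  have hlam1 := norm_lam1_prime_one_sub_one_le c' χ hq
  have hT := norm_tsum_left_diff_le c' χ hq hs
  have hW2q : W ^ 2 / (q : ℝ) ^ 2 ≤ W ^ 2 / q := by
    apply div_le_div_of_nonneg_left (sq_nonneg _) hq0
    calc (q : ℝ) = q * 1 := (mul_one _).symm
      _ ≤ q * q := by gcongr
      _ = (q : ℝ) ^ 2 := (sq _).symm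
  have hinner : ‖(lam1 c' χ q 1 - 1) + lam1 c' χ q 1 *
      ∑' r : ℕ, (if r = 0 then (0 : ℂ) else
        (kappa1 c' D (q ^ r) - kappaTilde1 c' χ (q ^ r) 1 1) / (q : ℂ) ^ ((r : ℂ) * s))‖ ≤
      8 / q + 5 * (W ^ 2 / q) := by
    calc _ ≤ ‖lam1 c' χ q 1 - 1‖ + ‖lam1 c' χ q 1 * ∑' r : ℕ, (if r = 0 then (0 : ℂ) else
          (kappa1 c' D (q ^ r) - kappaTilde1 c' χ (q ^ r) 1 1) / (q : ℂ) ^ ((r : ℂ) * s))‖ :=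
          norm_add_le _ _
      _ ≤ 8 / q + 5 * (W ^ 2 / q) := by
          rw [norm_mul]
          exact add_le_add hlam1 (mul_le_mul hlam (hT.trans hW2q) (norm_nonneg _) (by norm_num))
  calc _ ≤ 9 * (8 / q + 5 * (W ^ 2 / q)) :=
        mul_le_mul hZ hinner (norm_nonneg _) (by norm_num)
    _ = (72 + 45 * W ^ 2) / q := by ring

end Literature.NumberTheory.LFunctions.Zhang2022.Lemma153Rp


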